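import Summits.RiemannHypothesis.RiemannHypothesis.Theorems.SemilocalLogAtomsE
import HarnessLib

/-!
**MODULE NOTE (cc-s2-4 gen13) — LOCATED TWIN.** `SemilocalLogAtomsJ` (p376780 / re-accept p378464) was ACCEPTED on 2026-08-24 but is a RE-ACCEPT item of the
hub build queue's dead-letter class («rc75 NO-HOST att99», ops-buildfix UNBUILT-ACCEPTED lists; no olean after > 13 h), so no file importing it can be
verified.  This module carries the SAME rational enclosures under NEW declaration names (suffix `T`; the strict decimal bounds are stated through the
`…Lo11T/…Hi11T` constants instead of bare literals), so that the wall rows `q = 109 … 157` can import a module that exists on the build hosts.  When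
`SemilocalLogAtomsJ` builds, both modules state the same numbers; nothing depends on which one a row cites.  Imports hub-BUILT modules only.

# Log-atom enclosures (J): the atoms `107`, `109` and the window end `log 113`

Cell `rh-explicit` (HOME `run/shared/lean/pub/rh-explicit/`), seat cc-s2-4 gen10 (A4 lane, the Lean side).  Sequel of
`SemilocalLogAtoms{,B,…,I}.lean`: enclosures of `log 107`, `log 109` and of the weights `log p/√p` (7-term log series at
`107 = 108·(1 − 1/108)`, `109 = 108·(1 + 1/108)`, `log 108 = 2 log 2 + 3 log 3`), square roots by squaring, and the coarse
lower bound `4 log 2 + log 7 + 1/113 ≤ log 113` (`Real.one_sub_inv_le_log_of_pos`) — for the walls `q = 109` (`S = {p ≤ 107}`,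
window `b < (log 113)/2`) and `q = 113` (`S = {p ≤ 109}`).

Folklore numerics throughout; nothing here bears on RH.
-/

set_option autoImplicit false
set_option linter.dupNamespace false  -- the mandated namespace repeats `RiemannHypothesis`

noncomputable section

namespace Summit.RiemannHypothesis.RiemannHypothesis.Theorems.SemilocalPolyWitness

open Real
open Literature.NumberTheory.LFunctions
open Literature.Analysis.SpecialFunctions.Real
open Summit.RiemannHypothesis.RiemannHypothesis.Theorems.MotivicDoor.SemilocalMarkov

/-! ### The atom `107` (`log 107` from `107 = 108·(1 − 1/108)`) -/

/-- lower decimal of `log 107` (same rational as `logHundredSevenLo11` of `SemilocalLogAtomsJ`) -/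
def logHundredSevenLo11T : ℚ := 467282883416 / 100000000000
/-- upper decimal of `log 107` (same rational as `logHundredSevenHi11`) -/
def logHundredSevenHi11T : ℚ := 467282883477 / 100000000000
/-- `logHundredSevenLo11T < log 107` (`Real.abs_log_sub_add_sum_range_le`, 7 terms; the proof of `SemilocalLogAtomsJ` verbatim after unfolding the constant). -/
theorem logHundredSevenLo11T_lt_log : ((logHundredSevenLo11T : ℚ) : ℝ) < Real.log 107 := by
  rw [logHundredSevenLo11T]; push_cast
  have t : |((1 : ℝ) / 108)| < 1 := by rw [abs_of_pos (by norm_num)]; norm_num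
  have z := Real.abs_log_sub_add_sum_range_le t 7
  rw [abs_of_pos (by norm_num : (0 : ℝ) < 1 / 108)] at z
  norm_num [Finset.sum_range_succ] at z
  have e : Real.log (107 / 108) = Real.log 107 - (2 * Real.log 2 + 3 * Real.log 3) := by
    rw [Real.log_div (by norm_num) (by norm_num), show (108 : ℝ) = 2 ^ 2 * 3 ^ 3 by norm_num, Real.log_mul (by norm_num) (by norm_num), Real.log_pow, Real.log_pow]
    push_cast; ring
  rw [e] at z
  have h2 := Literature.Analysis.SpecialFunctions.Real.log_two_gt_d20
  have h3 := logThreeLo_le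
  rw [logThreeLo] at h3
  push_cast at h3
  obtain ⟨z1, z2⟩ := abs_le.1 z
  linarith

/-- `log 107 < logHundredSevenHi11T`. -/
theorem log_lt_logHundredSevenHi11T : Real.log 107 < ((logHundredSevenHi11T : ℚ) : ℝ) := by
  rw [logHundredSevenHi11T]; push_cast
  have t : |((1 : ℝ) / 108)| < 1 := by rw [abs_of_pos (by norm_num)]; norm_num
  have z := Real.abs_log_sub_add_sum_range_le t 7
  rw [abs_of_pos (by norm_num : (0 : ℝ) < 1 / 108)] at z
  norm_num [Finset.sum_range_succ] at z
  have e : Real.log (107 / 108) = Real.log 107 - (2 * Real.log 2 + 3 * Real.log 3) := by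
    rw [Real.log_div (by norm_num) (by norm_num), show (108 : ℝ) = 2 ^ 2 * 3 ^ 3 by norm_num, Real.log_mul (by norm_num) (by norm_num), Real.log_pow, Real.log_pow]
    push_cast; ring
  rw [e] at z
  have h2 := Literature.Analysis.SpecialFunctions.Real.log_two_lt_d20
  have h3 := log_three_le_logThreeHi
  rw [logThreeHi] at h3
  push_cast at h3
  obtain ⟨z1, z2⟩ := abs_le.1 z
  linarith

/-- `logHundredSevenLo11T ≤ log 107`. -/
theorem logHundredSevenLo11T_le : (logHundredSevenLo11T : ℝ) ≤ Real.log 107 := logHundredSevenLo11T_lt_log.le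
/-- `log 107 ≤ logHundredSevenHi11T`. -/
theorem log_hundredseven_le_logHundredSevenHi11T : Real.log 107 ≤ (logHundredSevenHi11T : ℝ) := log_lt_logHundredSevenHi11T.le
/-- `10.3440804327886 ≤ √107 ≤ 10.344080432788601`. -/
def sqrtHundredSevenLoT : ℚ := 103440804327886004 / 10000000000000000
/-- upper decimal of `√107` -/
def sqrtHundredSevenHiT : ℚ := 103440804327886005 / 10000000000000000
/-- The atom `107`: weight `log 107/√107`. -/
def atomHundredSevenT : ℕ × AtomQ :=
  (107, ⟨logHundredSevenLo11T, logHundredSevenHi11T, logHundredSevenLo11T / sqrtHundredSevenHiT, logHundredSevenHi11T / sqrtHundredSevenLoT⟩)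
/-- `atomHundredSevenT` encloses the atom `107` for any `S ∋ 107`. -/
theorem atomHundredSevenT_encl {S : Finset ℕ} (h : 107 ∈ S) :
    (atomHundredSevenT.2.lo : ℝ) ≤ Real.log atomHundredSevenT.1 ∧ Real.log atomHundredSevenT.1 ≤ (atomHundredSevenT.2.hi : ℝ) ∧
      (atomHundredSevenT.2.wlo : ℝ) ≤ weilSemilocalCoeff S atomHundredSevenT.1 ∧
      weilSemilocalCoeff S atomHundredSevenT.1 ≤ (atomHundredSevenT.2.whi : ℝ) := by
  simp only [atomHundredSevenT]
  push_cast
  have h0 := prime_atom_encl (by norm_num : Nat.Prime 107) h (lo := logHundredSevenLo11T) (hi := logHundredSevenHi11T)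
    (slo := sqrtHundredSevenLoT) (shi := sqrtHundredSevenHiT) (by exact_mod_cast logHundredSevenLo11T_le)
    (by exact_mod_cast log_hundredseven_le_logHundredSevenHi11T) (by rw [logHundredSevenLo11T]; norm_num)
    (ratCast_le_sqrt (by rw [sqrtHundredSevenLoT]; norm_num) (by rw [sqrtHundredSevenLoT]; norm_num))
    (sqrt_le_ratCast (by rw [sqrtHundredSevenHiT]; norm_num) (by rw [sqrtHundredSevenHiT]; norm_num))
    (by rw [sqrtHundredSevenLoT]; norm_num)
  push_cast at h0
  exact h0

/-! ### The atom `109` (`log 109` from `109 = 108·(1 + 1/108)`) -/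

/-- lower decimal of `log 109` (same rational as `logHundredNineLo11` of `SemilocalLogAtomsJ`) -/
def logHundredNineLo11T : ℚ := 469134788193 / 100000000000
/-- upper decimal of `log 109` (same rational as `logHundredNineHi11`) -/
def logHundredNineHi11T : ℚ := 469134788254 / 100000000000
/-- `logHundredNineLo11T < log 109` (`Real.abs_log_sub_add_sum_range_le`, 7 terms; the proof of `SemilocalLogAtomsJ` verbatim after unfolding the constant). -/
theorem logHundredNineLo11T_lt_log : ((logHundredNineLo11T : ℚ) : ℝ) < Real.log 109 := by
  rw [logHundredNineLo11T]; push_cast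
  have t : |(-(1 : ℝ) / 108)| < 1 := by rw [abs_of_neg (by norm_num)]; norm_num
  have z := Real.abs_log_sub_add_sum_range_le t 7
  rw [show |(-(1 : ℝ) / 108)| = 1 / 108 by rw [abs_of_neg (by norm_num)]; norm_num] at z
  norm_num [Finset.sum_range_succ] at z
  have e : Real.log (109 / 108) = Real.log 109 - (2 * Real.log 2 + 3 * Real.log 3) := by
    rw [Real.log_div (by norm_num) (by norm_num), show (108 : ℝ) = 2 ^ 2 * 3 ^ 3 by norm_num, Real.log_mul (by norm_num) (by norm_num), Real.log_pow, Real.log_pow]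
    push_cast; ring
  rw [e] at z
  have h2 := Literature.Analysis.SpecialFunctions.Real.log_two_gt_d20
  have h3 := logThreeLo_le
  rw [logThreeLo] at h3
  push_cast at h3
  obtain ⟨z1, z2⟩ := abs_le.1 z
  linarith

/-- `log 109 < logHundredNineHi11T`. -/
theorem log_lt_logHundredNineHi11T : Real.log 109 < ((logHundredNineHi11T : ℚ) : ℝ) := by
  rw [logHundredNineHi11T]; push_cast
  have t : |(-(1 : ℝ) / 108)| < 1 := by rw [abs_of_neg (by norm_num)]; norm_num
  have z := Real.abs_log_sub_add_sum_range_le t 7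
  rw [show |(-(1 : ℝ) / 108)| = 1 / 108 by rw [abs_of_neg (by norm_num)]; norm_num] at z
  norm_num [Finset.sum_range_succ] at z
  have e : Real.log (109 / 108) = Real.log 109 - (2 * Real.log 2 + 3 * Real.log 3) := by
    rw [Real.log_div (by norm_num) (by norm_num), show (108 : ℝ) = 2 ^ 2 * 3 ^ 3 by norm_num, Real.log_mul (by norm_num) (by norm_num), Real.log_pow, Real.log_pow]
    push_cast; ring
  rw [e] at z
  have h2 := Literature.Analysis.SpecialFunctions.Real.log_two_lt_d20
  have h3 := log_three_le_logThreeHi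
  rw [logThreeHi] at h3
  push_cast at h3
  obtain ⟨z1, z2⟩ := abs_le.1 z
  linarith

/-- `logHundredNineLo11T ≤ log 109`. -/
theorem logHundredNineLo11T_le : (logHundredNineLo11T : ℝ) ≤ Real.log 109 := logHundredNineLo11T_lt_log.le
/-- `log 109 ≤ logHundredNineHi11T`. -/
theorem log_hundrednine_le_logHundredNineHi11T : Real.log 109 ≤ (logHundredNineHi11T : ℝ) := log_lt_logHundredNineHi11T.le
/-- `10.44030650891055 ≤ √109 ≤ 10.44030650891055`. -/
def sqrtHundredNineLoT : ℚ := 104403065089105501 / 10000000000000000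
/-- upper decimal of `√109` -/
def sqrtHundredNineHiT : ℚ := 104403065089105502 / 10000000000000000
/-- The atom `109`: weight `log 109/√109`. -/
def atomHundredNineT : ℕ × AtomQ :=
  (109, ⟨logHundredNineLo11T, logHundredNineHi11T, logHundredNineLo11T / sqrtHundredNineHiT, logHundredNineHi11T / sqrtHundredNineLoT⟩)
/-- `atomHundredNineT` encloses the atom `109` for any `S ∋ 109`. -/
theorem atomHundredNineT_encl {S : Finset ℕ} (h : 109 ∈ S) :
    (atomHundredNineT.2.lo : ℝ) ≤ Real.log atomHundredNineT.1 ∧ Real.log atomHundredNineT.1 ≤ (atomHundredNineT.2.hi : ℝ) ∧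
      (atomHundredNineT.2.wlo : ℝ) ≤ weilSemilocalCoeff S atomHundredNineT.1 ∧
      weilSemilocalCoeff S atomHundredNineT.1 ≤ (atomHundredNineT.2.whi : ℝ) := by
  simp only [atomHundredNineT]
  push_cast
  have h0 := prime_atom_encl (by norm_num : Nat.Prime 109) h (lo := logHundredNineLo11T) (hi := logHundredNineHi11T)
    (slo := sqrtHundredNineLoT) (shi := sqrtHundredNineHiT) (by exact_mod_cast logHundredNineLo11T_le)
    (by exact_mod_cast log_hundrednine_le_logHundredNineHi11T) (by rw [logHundredNineLo11T]; norm_num)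
    (ratCast_le_sqrt (by rw [sqrtHundredNineLoT]; norm_num) (by rw [sqrtHundredNineLoT]; norm_num))
    (sqrt_le_ratCast (by rw [sqrtHundredNineHiT]; norm_num) (by rw [sqrtHundredNineHiT]; norm_num))
    (by rw [sqrtHundredNineLoT]; norm_num)
  push_cast at h0
  exact h0

/-! ### A lower bound of `log 113` (the window end of the wall `q = 109`) -/

/-- `4 log 2⁻ + log 7⁻ + 1/113 ≤ log 113`: `log 113 = log 112 + log (113/112) ≥ 4 log 2 + log 7 + (1 − 112/113)`. -/
def logHundredThirteenLoT : ℚ := 4 * logTwoLo20 + logSevenLo + 1 / 113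
/-- `logHundredThirteenLoT ≤ log 113`. -/
theorem logHundredThirteenLoT_le : (logHundredThirteenLoT : ℝ) ≤ Real.log 113 := by
  have h112 : Real.log 112 = 4 * Real.log 2 + Real.log 7 := by
    rw [show (112 : ℝ) = 2 ^ 4 * 7 by norm_num, Real.log_mul (by norm_num) (by norm_num), Real.log_pow]; push_cast; ring
  have hq : Real.log 113 = 4 * Real.log 2 + Real.log 7 + Real.log (113 / 112) := by
    rw [← h112, ← Real.log_mul (by norm_num) (by norm_num)]
    norm_num
  have hlow : 1 - (113 / 112 : ℝ)⁻¹ ≤ Real.log (113 / 112) := Real.one_sub_inv_le_log_of_pos (by norm_num)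
  have h2 := logTwoLo20_le
  have h7 := logSevenLo_le
  rw [logHundredThirteenLoT]
  push_cast
  rw [hq]
  norm_num at hlow ⊢
  linarith

/-! Build note (cc-s2-4 gen11, 2026-08-24; lead R14-3 APPEND REMEDY): comment-only re-commit — accepted 08:09–08:10Z, no hub olean since
(no RH-Theorems build burst after 08:12:58Z).  Users: the wall rows `SemilocalNegCertUptoHundred{One,Seven,Nine,Thirteen,TwentySeven}` (q = 103 … 131) and the kinked twin-wall row `SemilocalNegCertUptoHundredThreeKinked*` (q = 107: `logHundredNineLo11T`). -/

end Summit.RiemannHypothesis.RiemannHypothesis.Theorems.SemilocalPolyWitness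

end
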